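import Literature.AlgebraicGeometry.Resolution.KnafKuhlmann2009HenselianRationality
import Literature.AlgebraicGeometry.Resolution.KnafKuhlmann2009HenselianRationalityEtale
import Literature.AlgebraicGeometry.Resolution.KnafKuhlmann2009Prop310
import Literature.AlgebraicGeometry.Resolution.LocalEtaleUniformization
import HarnessLib

/-!
# Knaf–Kuhlmann 2009, Thm. 3.8 + Lemma 3.7: the assembly from the Hensel-root kernel

Topic: `Literature/AlgebraicGeometry/Resolution`. Proof companion of
`KnafKuhlmann2009HenselianRationality.lean`. The named fact
`KnafKuhlmann2009_Thm38_Lemma37_sepClosed` (Knaf–Kuhlmann 2009, Thm. 3.8 combined with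
Lemma 3.7 (2), (3): an immediate separable function field of transcendence degree `1` over a
separably closed `K` is strongly smoothly `O_{K(x)}`-uniformizable for a suitable
transcendence basis `{x}`) FOLLOWS from its valuation-theoretic kernel
`KnafKuhlmann2009_Thm38_sepClosed` (Thm. 3.8, henselian rationality, in Hensel-root form:
`F = K(x)(η)` with `η ∈ O_P` a root of a monic `f` over `O_{K(x)}`, `f'(η) ∈ O_P^×`) by the
PROVED Lemma 3.7 (2) ⇐ (`isSmoothlyUniformizableIn_of_henselRoot`,
`LocalEtaleUniformization.lean`: the standard-étale model `O_{K(x)}[η][1/μ'(η)]`, `μ` the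
minimal polynomial of `η`, serves every finite `Z ⊆ O_P`). This is the step "Lemma 3.7, (2)
and (3) yield that `P` is strongly smoothly `O_{K(x)}`-uniformizable" of the printed proof of
Prop. 3.10 (p. 14 of arXiv:math/0702856), with (3) folded into the rendering of Thm. 3.8 and
(2) proved.

* `KnafKuhlmann2009_Thm38_Lemma37_sepClosed.of_thm38` — PROVED:
  `KnafKuhlmann2009_Thm38_sepClosed → KnafKuhlmann2009_Thm38_Lemma37_sepClosed`.
* `KnafKuhlmann2009_Thm38_sepClosed.of_localEtale` — PROVED: the Hensel-root kernel is implied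
  by the local-étale kernel `KnafKuhlmann2009_Thm38_localEtale_sepClosed` of the parallel file
  `KnafKuhlmann2009HenselianRationalityEtale.lean` (which vendors Thm. 3.8 + Lemma 3.7 (3) WITH
  the standard-étale data `f'h + f p₂ = gˢ`, `f` of least degree, and the representation
  `O_F = (O_E[η]_{g(η)})_q`): evaluate `f'h + f p₂ = gˢ` at `η`. So the Hensel-root kernel is
  the logically weaker (hence preferable) assumption of the two; the representation clause and
  the minimality it drops are theorems (`exists_isIntegral_mul_eq`, Euler's lemma, minimal
  polynomials over the normal `O_E`; `LocalEtaleUniformization.lean`).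
* `exists_aeval_repr_of_henselRoot` — PROVED: for `F = L(η)` with `η` a Hensel root over
  `O_L`, the minimal polynomial `μ` of `η` over `O_L` has `μ'(η) ∈ O_P^×` and every `z ∈ O_F`
  is `q₁(η)/q₂(η)` with `q₁, q₂` over `O_L`, `v(q₂(η)) = 0` — the identification
  `B_{q_B} = O_P` of the proof of Lemma 3.7 (1), via `exists_isIntegral_mul_eq` and Euler's
  lemma (`LocalEtaleUniformization.lean`).
* `KnafKuhlmann2009_Thm38_localEtale_sepClosed.of_thm38` — PROVED, the converse of
  `…of_localEtale`: the Hensel-root kernel implies the local-étale kernel (with `f := μ`,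
  `g := μ'`, `h := 1`, `p₂ := 0`, `s := 1`). Hence the two renderings of Thm. 3.8 in the topic
  are EQUIVALENT modulo proved mathematics, and either may serve as the single remaining
  named fact under `KnafKuhlmann2009` on the henselian-rationality side.
* `KnafKuhlmann2009_Prop310_sepClosed.of_thm38_henselRoot`,
  `KnafKuhlmann2009_Thm11.of_thm38_henselRoot`, `KnafKuhlmann2009_Thm12.of_thm38_henselRoot`,
  `KnafKuhlmann2009.of_thm38_henselRoot` — corollaries (composition with
  `KnafKuhlmann2009Prop310.lean`): Prop. 3.10, Thm. 1.1, Thm. 1.2 as printed and the fact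
  `KnafKuhlmann2009` from `KnafKuhlmann2009_Thm38_sepClosed` (and `KnafKuhlmann2005_Thm34_etale`
  for the last two). Trust base of `KnafKuhlmann2009` along this line:
  `{KnafKuhlmann2009_Thm38_sepClosed, KnafKuhlmann2005_Thm34_etale}`.

What remains a named fact is exactly Thm. 3.8 for separably closed `K` ([K8] = F.-V.
Kuhlmann, *Elimination of ramification II: Henselian rationality*, Israel J. Math. 234
(2019)); already its residue-characteristic-`0` case ("every `x ∈ F ∖ K` will then do the
job", p. 13) needs the henselization and Ostrowski's defect formula, which Mathlib lacks.

## Source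

* H. Knaf, F.-V. Kuhlmann, *Every place admits local uniformization in a finite extension of
  the function field*, Adv. Math. 221 (2009) 428–453 = arXiv:math/0702856, Lemma 3.7,
  Thm. 3.8 (p. 13), proof of Prop. 3.10 (p. 14), Thm. 1.1, Thm. 1.2.
-/

noncomputable section

namespace Literature.AlgebraicGeometry.Resolution

universe u

open Polynomial IsLocalRing Pointwise

/-- **Knaf–Kuhlmann 2009, Thm. 3.8 + Lemma 3.7 (2), (3) from Thm. 3.8 in Hensel-root form**:
given `x` and the Hensel root `η` over `O_{K(x)}` generating `F`, every finite `Z ⊆ O_P` is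
smoothly `O_{K(x)}`-uniformizable by `isSmoothlyUniformizableIn_of_henselRoot` (Lemma 3.7 (2)
⇐, proved). [cite: KnafKuhlmann2009, Lemma 3.7 and Thm. 3.8 (proof of Prop. 3.10, p. 14)] -/
theorem KnafKuhlmann2009_Thm38_Lemma37_sepClosed.of_thm38
    (h : KnafKuhlmann2009_Thm38_sepClosed.{u}) :
    KnafKuhlmann2009_Thm38_Lemma37_sepClosed.{u} := by
  intro Ω _ V K F hK hKF hfg hsep h1 himm
  obtain ⟨x, hxF, hx, η, hηV, f, hgen, hmon, hcoeff, hfη, hder⟩ :=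
    h Ω V K F hK hKF hfg hsep h1 himm
  exact ⟨x, hxF, hx, fun Z hZ => isSmoothlyUniformizableIn_of_henselRoot V _ F hηV hgen f hmon
    hcoeff hfη hder (Z : Set Ω) fun z hz => hZ z (Finset.mem_coe.mp hz)⟩

/-- **The Hensel-root kernel from the local-étale kernel**: the standard-étale data of
`KnafKuhlmann2009_Thm38_localEtale_sepClosed` contain a Hensel root, since evaluating
`f'h + f p₂ = gˢ` at the root `η` of `f` gives `f'(η) h(η) = g(η)ˢ ∈ O_P^×` with
`f'(η), h(η) ∈ O_P`, whence `f'(η) ∈ O_P^×`. [folklore] -/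
theorem KnafKuhlmann2009_Thm38_sepClosed.of_localEtale
    (h : KnafKuhlmann2009_Thm38_localEtale_sepClosed.{u}) :
    KnafKuhlmann2009_Thm38_sepClosed.{u} := by
  intro Ω _ V K F hK hKF hfg hsep h1 himm
  obtain ⟨x, hxF, hx, η, f, g, hh, p₂, s, hηV, hgen, hfmon, hfη, hcoef, -, hident, hvg, -⟩ :=
    h Ω V K F hK hKF hfg hsep h1 himm
  refine ⟨x, hxF, hx, η, hηV, f, hgen, hfmon, hcoef f (by simp), hfη, ?_⟩
  -- values of polynomials over `O_E` at `η ∈ O_V` are `≤ 1`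
  have hval : ∀ P : Polynomial Ω, (∀ k, P.coeff k ∈ V) → V.valuation (P.eval η) ≤ 1 :=
    fun P hP => (V.valuation_le_one_iff _).mpr (eval_mem_of_coeff_mem V P hP hηV)
  have hderV : ∀ k, (derivative f).coeff k ∈ V := fun k => by
    rw [coeff_derivative]
    exact mul_mem (hcoef f (by simp) _).1 (by exact_mod_cast natCast_mem V (k + 1))
  have heval : (derivative f).eval η * hh.eval η = g.eval η ^ s := by
    have := congrArg (fun P : Polynomial Ω => P.eval η) hident
    simpa only [eval_add, eval_mul, hfη, zero_mul, add_zero, eval_pow] using this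
  refine le_antisymm (hval _ hderV) ?_
  calc (1 : V.ValueGroup) = V.valuation (g.eval η ^ s) := by rw [map_pow, hvg, one_pow]
    _ = V.valuation ((derivative f).eval η) * V.valuation (hh.eval η) := by
        rw [← heval, map_mul]
    _ ≤ V.valuation ((derivative f).eval η) :=
        mul_le_of_le_one_right' (hval hh fun k => (hcoef hh (by simp) k).1)

/-! ## Corollaries: Prop. 3.10, Thm. 1.1, Thm. 1.2 and `KnafKuhlmann2009` from the kernel -/

/-- **Knaf–Kuhlmann 2009, Prop. 3.10 (separably closed ground field) from Thm. 3.8 in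
Hensel-root form.** [cite: KnafKuhlmann2009, Prop. 3.10] -/
theorem KnafKuhlmann2009_Prop310_sepClosed.of_thm38_henselRoot
    (h38 : KnafKuhlmann2009_Thm38_sepClosed.{u}) : KnafKuhlmann2009_Prop310_sepClosed.{u} :=
  KnafKuhlmann2009_Prop310_sepClosed.of_thm38
    (KnafKuhlmann2009_Thm38_Lemma37_sepClosed.of_thm38 h38)

/-- **Knaf–Kuhlmann 2009, Thm. 1.1 from Thm. 3.8 in Hensel-root form.**
[cite: KnafKuhlmann2009, Thm. 1.1] -/
theorem KnafKuhlmann2009_Thm11.of_thm38_henselRoot (h38 : KnafKuhlmann2009_Thm38_sepClosed.{u}) :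
    KnafKuhlmann2009_Thm11.{u} :=
  KnafKuhlmann2009_Thm11.of_thm38 (KnafKuhlmann2009_Thm38_Lemma37_sepClosed.of_thm38 h38)

/-- **Knaf–Kuhlmann 2009, Thm. 1.2 (as printed, first paragraph) from Thm. 3.8 in Hensel-root
form and KK05 Thm. 3.4.** [cite: KnafKuhlmann2009, Thm. 1.2] -/
theorem KnafKuhlmann2009_Thm12.of_thm38_henselRoot (h38 : KnafKuhlmann2009_Thm38_sepClosed.{u})
    (h34 : KnafKuhlmann2005_Thm34_etale.{u}) : KnafKuhlmann2009_Thm12.{u} :=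
  KnafKuhlmann2009_Thm12.of_thm38 (KnafKuhlmann2009_Thm38_Lemma37_sepClosed.of_thm38 h38) h34

/-- **The named fact `KnafKuhlmann2009` from henselian rationality in Hensel-root form and
inertial generation**: trust base `{KnafKuhlmann2009_Thm38_sepClosed, KnafKuhlmann2005_Thm34_etale}`.
[cite: KnafKuhlmann2009, Thm. 1.2] -/
theorem KnafKuhlmann2009.of_thm38_henselRoot (h38 : KnafKuhlmann2009_Thm38_sepClosed.{u})
    (h34 : KnafKuhlmann2005_Thm34_etale.{u}) : KnafKuhlmann2009.{u} :=
  KnafKuhlmann2009.of_thm38 (KnafKuhlmann2009_Thm38_Lemma37_sepClosed.of_thm38 h38) h34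

/-! ## The two kernels are equivalent: `O_F = O_{K(x)}[η]_q` for a Hensel root `η` -/

section Converse

variable {Ω : Type u} [Field Ω]

/-- **The valuation ring `O_F` of a Hensel-root extension is the local ring of `O_L[η]` at the
centre** (the identification `B_{q_B} = O_P` of the proof of Knaf–Kuhlmann 2009, Lemma 3.7
(1), in the form used by Lemma 3.7 (2)): if `F = L(η)` with `η ∈ O_V` a root of a monic `f`
over `O_L = V ∩ L` with `v(f'(η)) = 0`, then the minimal polynomial `μ` of `η` over `O_L` has
`v(μ'(η)) = 0`, and every `z ∈ O_V ∩ F` is `q₁(η)/q₂(η)` with `q₁, q₂` over `O_L` and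
`v(q₂(η)) = 0`. [cite: KnafKuhlmann2009, Lemma 3.7 (proof of (1))] -/
theorem exists_aeval_repr_of_henselRoot (V : ValuationSubring Ω) (L F : Subfield Ω)
    {η : Ω} (hηV : η ∈ V) (hgen : Subfield.closure ((L : Set Ω) ∪ {η}) = F)
    (f : Polynomial Ω) (hfmon : f.Monic) (hfcoeff : ∀ k, f.coeff k ∈ V ∧ f.coeff k ∈ L)
    (hfη : f.eval η = 0) (hfder : V.valuation ((derivative f).eval η) = 1) :
    IsIntegral ↥(V.toSubring ⊓ L.toSubring) η ∧
    V.valuation (aeval η (derivative (minpoly ↥(V.toSubring ⊓ L.toSubring) η))) = 1 ∧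
    ∀ z ∈ F, z ∈ V → ∃ q₁ q₂ : Polynomial ↥(V.toSubring ⊓ L.toSubring),
      V.valuation (aeval η q₂) = 1 ∧ z = aeval η q₁ / aeval η q₂ := by
  classical
  haveI : IsIntegrallyClosed ↥(V.toSubring ⊓ L.toSubring) := isIntegrallyClosed_inf V L
  -- `f` over `O_L`; `η` is integral with minimal polynomial `μ`, `δ := μ'(η)` a unit of `O_V`
  obtain ⟨fO, hfO, hfOmon⟩ : ∃ fO : Polynomial ↥(V.toSubring ⊓ L.toSubring),
      fO.map (algebraMap _ Ω) = f ∧ fO.Monic := by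
    have hl : f ∈ Polynomial.lifts (algebraMap ↥(V.toSubring ⊓ L.toSubring) Ω) :=
      (Polynomial.lifts_iff_coeff_lifts f).mpr fun k =>
        ⟨⟨f.coeff k, (hfcoeff k).1, (hfcoeff k).2⟩, rfl⟩
    obtain ⟨fO, hfO, -, hmon⟩ := Polynomial.lifts_and_degree_eq_and_monic hl hfmon
    exact ⟨fO, hfO, hmon⟩
  have hfOη : aeval η fO = 0 := by rw [aeval_def, ← eval_map, hfO, hfη]
  have hint : IsIntegral ↥(V.toSubring ⊓ L.toSubring) η := ⟨fO, hfOmon, by rw [← aeval_def, hfOη]⟩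
  set μ := minpoly ↥(V.toSubring ⊓ L.toSubring) η with hμ
  set δ : Ω := aeval η (derivative μ) with hδ
  have hOval : ∀ q : Polynomial ↥(V.toSubring ⊓ L.toSubring), V.valuation (aeval η q) ≤ 1 := by
    intro q
    rw [V.valuation_le_one_iff, aeval_eq_sum_range]
    exact sum_mem fun k _ => by
      rw [Algebra.smul_def]; exact mul_mem (q.coeff k).2.1 (pow_mem hηV k)
  have hder : V.valuation δ = 1 := by
    obtain ⟨g, hg⟩ := minpoly.isIntegrallyClosed_dvd hint hfOη
    have h1 : (derivative f).eval η = δ * aeval η g := by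
      rw [← hfO, derivative_map, eval_map, ← aeval_def, hg, derivative_mul, map_add, map_mul,
        map_mul, minpoly.aeval, zero_mul, add_zero]
    rw [h1, map_mul] at hfder
    refine le_antisymm (hOval _) ?_
    calc (1 : V.ValueGroup) = V.valuation δ * V.valuation (aeval η g) := hfder.symm
      _ ≤ V.valuation δ := mul_le_of_le_one_right' (hOval g)
  have hδ0 : δ ≠ 0 := fun h0 => by rw [h0, map_zero] at hder; exact zero_ne_one hder
  refine ⟨hint, hder, fun z hzF hzV => ?_⟩
  -- the tower `O_L → L → L⟮η⟯ = F`
  let ι : ↥(V.toSubring ⊓ L.toSubring) →+* L :=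
    Subring.inclusion (inf_le_right : V.toSubring ⊓ L.toSubring ≤ L.toSubring)
  letI : Algebra ↥(V.toSubring ⊓ L.toSubring) L := ι.toAlgebra
  haveI : IsScalarTower ↥(V.toSubring ⊓ L.toSubring) L Ω :=
    IsScalarTower.of_algebraMap_eq fun _ => rfl
  haveI : IsFractionRing ↥(V.toSubring ⊓ L.toSubring) L := isFractionRing_inf V L
  set Fη : IntermediateField L Ω := IntermediateField.adjoin L ({η} : Set Ω) with hFη
  haveI : IsScalarTower ↥(V.toSubring ⊓ L.toSubring) L Fη :=
    IsScalarTower.of_algebraMap_eq fun _ => rfl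
  haveI : IsScalarTower ↥(V.toSubring ⊓ L.toSubring) Fη Ω :=
    IsScalarTower.of_algebraMap_eq fun _ => rfl
  have hηint : IsIntegral L η := hint.tower_top
  haveI : FiniteDimensional L Fη := IntermediateField.adjoin.finiteDimensional hηint
  have hmin : minpoly L η = μ.map (algebraMap _ L) :=
    minpoly.isIntegrallyClosed_eq_field_fractions' L hint
  have hsep : IsSeparable L η := by
    refine (separable_iff_derivative_ne_zero (minpoly.irreducible hηint)).mpr fun h0 => hδ0 ?_
    have : aeval η (derivative (minpoly L η)) = δ := by
      rw [hmin, derivative_map, aeval_map_algebraMap]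
    rw [← this, h0, map_zero]
  haveI : Algebra.IsSeparable L Fη :=
    (IntermediateField.isSeparable_adjoin_simple_iff_isSeparable L Ω).mpr hsep
  set x : Fη := IntermediateField.AdjoinSimple.gen L η with hxdef
  have hxint : IsIntegral ↥(V.toSubring ⊓ L.toSubring) x :=
    (isIntegral_algHom_iff (IsScalarTower.toAlgHom ↥(V.toSubring ⊓ L.toSubring) Fη Ω)
      Subtype.val_injective).mp hint
  have hx : Algebra.adjoin L {x} = ⊤ := by
    have := (IntermediateField.adjoin.powerBasis hηint).adjoin_gen_eq_top
    rwa [IntermediateField.adjoin.powerBasis_gen] at this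
  have hδ' : ((aeval x (derivative (minpoly L x)) : Fη) : Ω) = δ := by
    rw [hxdef, IntermediateField.minpoly_gen, hmin, derivative_map, ← IntermediateField.aeval_coe,
      aeval_map_algebraMap]
    rfl
  have hadj : ∀ a ∈ Algebra.adjoin ↥(V.toSubring ⊓ L.toSubring) {x},
      ∃ q : Polynomial ↥(V.toSubring ⊓ L.toSubring), ((a : Fη) : Ω) = aeval η q := by
    intro a ha
    rw [Algebra.adjoin_singleton_eq_range_aeval] at ha
    obtain ⟨q, rfl⟩ := ha
    refine ⟨q, ?_⟩
    change ((aeval x q : Fη) : Ω) = aeval η q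
    rw [← IntermediateField.aeval_coe]
    rfl
  have hzFη : z ∈ Fη := by
    rw [hFη, mem_adjoin_subfield_iff, hgen]
    exact hzF
  obtain ⟨r, s, hrint, hsint, hvs, hrs⟩ := exists_isIntegral_mul_eq V L η hzV hzFη
  obtain ⟨q₁, hq₁⟩ := hadj _ (derivative_mul_mem_adjoin_of_isIntegral ↥(V.toSubring ⊓ L.toSubring)
    L hx hxint hrint)
  obtain ⟨q₂, hq₂⟩ := hadj _ (derivative_mul_mem_adjoin_of_isIntegral ↥(V.toSubring ⊓ L.toSubring)
    L hx hxint hsint)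
  rw [IntermediateField.coe_mul, hδ'] at hq₁ hq₂
  have hs0 : (s : Ω) ≠ 0 := fun h0 => by
    rw [h0, map_zero] at hvs
    exact zero_ne_one hvs
  refine ⟨q₁, q₂, ?_, ?_⟩
  · rw [← hq₂, map_mul, hder, hvs, one_mul]
  · rw [← hq₁, ← hq₂, hrs]
    field_simp

/-- **The local-étale kernel from the Hensel-root kernel** (so the two renderings of Thm. 3.8,
`KnafKuhlmann2009_Thm38_sepClosed` and `KnafKuhlmann2009_Thm38_localEtale_sepClosed`, are
EQUIVALENT modulo proved mathematics): with `E = K(x)` and the Hensel root `η`, take `f :=` the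
minimal polynomial `μ` of `η` over the normal domain `O_E` (of least degree among the non-zero
polynomials over `E = Frac O_E` vanishing at `η`), `g := μ'`, `h := 1`, `p₂ := 0`, `s := 1`;
`μ'(η) ∈ O_P^×` and `O_F = O_E[η]_q` by `exists_aeval_repr_of_henselRoot`.
[cite: KnafKuhlmann2009, Lemma 3.7] -/
theorem KnafKuhlmann2009_Thm38_localEtale_sepClosed.of_thm38
    (h : KnafKuhlmann2009_Thm38_sepClosed.{u}) :
    KnafKuhlmann2009_Thm38_localEtale_sepClosed.{u} := by
  intro Ω _ V K F hK hKF hfg hsep h1 himm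
  classical
  obtain ⟨x, hxF, hx, η, hηV, f, hgen, hfmon, hcoef, hfη, hfder⟩ :=
    h Ω V K F hK hKF hfg hsep h1 himm
  set E : Subfield Ω := Subfield.closure ((K : Set Ω) ∪ {x}) with hE
  obtain ⟨hint, hder, hrepr⟩ :=
    exists_aeval_repr_of_henselRoot V E F hηV hgen f hfmon hcoef hfη hfder
  haveI : IsIntegrallyClosed ↥(V.toSubring ⊓ E.toSubring) := isIntegrallyClosed_inf V E
  set μ := minpoly ↥(V.toSubring ⊓ E.toSubring) η with hμ
  -- polynomials over `O_E` pushed to `Ω`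
  have hmapcoef : ∀ (q : Polynomial ↥(V.toSubring ⊓ E.toSubring)) (k : ℕ),
      (q.map (algebraMap _ Ω)).coeff k ∈ V ∧ (q.map (algebraMap _ Ω)).coeff k ∈ E := by
    intro q k
    rw [coeff_map]
    exact ⟨(q.coeff k).2.1, (q.coeff k).2.2⟩
  have hmapeval : ∀ q : Polynomial ↥(V.toSubring ⊓ E.toSubring),
      (q.map (algebraMap _ Ω)).eval η = aeval η q := fun q => by rw [eval_map, aeval_def]
  refine ⟨x, hxF, hx, η, μ.map (algebraMap _ Ω), (derivative μ).map (algebraMap _ Ω), 1, 0, 1,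
    hηV, hgen, (minpoly.monic hint).map _, ?_, ?_, ?_, ?_, ?_, ?_⟩
  · rw [hmapeval, minpoly.aeval]
  · intro P hP k
    simp only [Set.mem_insert_iff, Set.mem_singleton_iff] at hP
    rcases hP with rfl | rfl | rfl | rfl
    · exact hmapcoef _ k
    · exact hmapcoef _ k
    · rw [coeff_one]
      split_ifs
      · exact ⟨V.one_mem, E.one_mem⟩
      · exact ⟨V.zero_mem, E.zero_mem⟩
    · rw [coeff_zero]; exact ⟨V.zero_mem, E.zero_mem⟩
  · -- minimality: `μ` is the minimal polynomial of `η` over the field `E = Frac O_E` too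
    intro P hPE hP0 hPη
    let ι : ↥(V.toSubring ⊓ E.toSubring) →+* E :=
      Subring.inclusion (inf_le_right : V.toSubring ⊓ E.toSubring ≤ E.toSubring)
    letI : Algebra ↥(V.toSubring ⊓ E.toSubring) E := ι.toAlgebra
    haveI : IsScalarTower ↥(V.toSubring ⊓ E.toSubring) E Ω :=
      IsScalarTower.of_algebraMap_eq fun _ => rfl
    haveI : IsFractionRing ↥(V.toSubring ⊓ E.toSubring) E := isFractionRing_inf V E
    have hmin : minpoly E η = μ.map (algebraMap _ E) :=
      minpoly.isIntegrallyClosed_eq_field_fractions' E hint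
    obtain ⟨PE, hPE'⟩ : ∃ PE : Polynomial E, PE.map (algebraMap E Ω) = P :=
      (Polynomial.mem_lifts P).mp
        ((Polynomial.lifts_iff_coeff_lifts P).mpr fun k => ⟨⟨P.coeff k, hPE k⟩, rfl⟩)
    have hPE0 : PE ≠ 0 := by
      rintro rfl
      rw [Polynomial.map_zero] at hPE'
      exact hP0 hPE'.symm
    have hPEη : aeval η PE = 0 := by rw [aeval_def, ← eval_map, hPE', hPη]
    have h1 : (minpoly E η).natDegree ≤ PE.natDegree :=
      natDegree_le_of_dvd (minpoly.dvd E η hPEη) hPE0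
    rw [natDegree_map_eq_of_injective Subtype.val_injective]
    calc μ.natDegree = (minpoly E η).natDegree := by
          rw [hmin, natDegree_map_eq_of_injective (Subring.inclusion_injective _)]
      _ ≤ PE.natDegree := h1
      _ = P.natDegree := by rw [← hPE', natDegree_map_eq_of_injective Subtype.val_injective]
  · rw [← Polynomial.derivative_map, mul_one, mul_zero, add_zero, pow_one]
  · rw [hmapeval]
    exact hder
  · intro z hzF hzV
    obtain ⟨q₁, q₂, hvq₂, hz⟩ := hrepr z hzF hzV
    refine ⟨q₁.map (algebraMap _ Ω), q₂.map (algebraMap _ Ω), 0, ?_, ?_, ?_⟩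
    · intro P hP k
      simp only [Set.mem_insert_iff, Set.mem_singleton_iff] at hP
      rcases hP with rfl | rfl
      · exact hmapcoef _ k
      · exact hmapcoef _ k
    · rw [hmapeval]; exact hvq₂
    · rw [hmapeval, hmapeval, pow_zero, mul_one]; exact hz

end Converse

end Literature.AlgebraicGeometry.Resolution

end
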